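import Literature.MathematicalPhysics.QuantumFieldTheory.Balaban1983to89.B6Prop22MultiLevelBoxL0
import Literature.MathematicalPhysics.QuantumFieldTheory.Balaban1983to89.B6Prop22LapMultiLevelBox
/-!
# `Balaban1983to89.B6Prop22LapMultiLevelBoxL0` — LEVEL-0 TWIN (programme G-F3′-L0, director-ym LINE №27 / UV3-NODE §24.5; plan `lit-balaban-r03/G-F3L0-PLAN.md`) of `B6Prop22LapMultiLevelBox`:
the same declarations, SAME NAMES AND STATEMENTS, for nested families WITH print's region `Λ₀ = T ∖ Ω₁` ADMITTED (structures
`B6MultiLevelBoxOperatorL0.Domains` / `B6MultiLevelTorusOperatorL0.TDomains`: levels `0, …, k`, the level-`0` block a single site, `Q′₀ = id`,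
finite weight `a₀` — print p.225 (2.14) «Σ_{j=0}^k … (Q′₀λ)(x) = λ(x), x ∈ Λ₀», p.229 «taking a sequence (2.1) … smallest possible domains B^j(Λ_j),
and considering the operator Δ_a defined by (2.19), (2.20) for this sequence»).  Every `D`-free object is the lineage's, consumed BY NAME; no existing
module is touched; no fact is minted.  Unit `lit-balaban-p21` (packet S-B owner, p21 gen 26; port tooling by r03 gen 36); B6 fold owner r03; referee ref-4.  THE TWIN'S DOCUMENTATION FOLLOWS
VERBATIM (its «levels 1 … k» / «Ω₁ = X» sentences describe the twin; here `j` runs from `0` and `Ω₁` may be a proper subset).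

# `Balaban1983to89.B6Prop22LapMultiLevelBox` — [B6] PROPOSITION 2.2, SIXTH ENTRY OF (2.67) (`|Δ^ηG′λ|`), FOR THE
GENUINE `k`-LEVEL OPERATOR `G′ = Δ′_a^{−1}` ON A BOX: `|(Δ^ηG′λ)(x)| ≤ O(1)·e^{−½δ₀d(y,y′)}|λ|`, `x ∈ B^j(y)`,
`supp λ ⊂ B^{j′}(y′)` — from the first entry (file 5) and the algebra `−Δ^ηG′ = 1 − Q′*aQ′G′` of (2.13)–(2.14)
(file 7 of the multi-level parametrix; no existing module is touched; no fact is minted)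

FRAMING (verbatim cell line):
statement-level skeleton of published theorems with citation tags; proofs where landed; nothing here is a claim about the Yang–Mills mass gap

Source under audit (cell pub-balaban / lit-balaban): T. Bałaban, *Propagators and renormalization transformations for
lattice gauge theories. II*, Commun. Math. Phys. **96** (1984) 223–250 [`Balaban1984PropagatorsII`, "B6"], p. 225
[PDF 3] (2.13)–(2.14), p. 234 [PDF 12] (2.67), Proposition 2.2 (renders
`run/shared/lean/pub/pub-balaban/b2b-balaban-ref1/pages/1984-cmp96-propagators-rt-II/…-p003/p012-x2.png`, read as images
this generation).  Unit `lit-balaban-p21` (Phase-2 proof seat p21 gen 10), HOME `run/shared/lean/pub/lit-balaban/`,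
B6 fold owner r03, referee ref-4.

## WHAT IS PRINTED (verbatim up to notation)

p. 225: «Δ′_a = Δ + Q′*aQ′ and the operator Q′*aQ′ is given by the quadratic form
⟨λ, Q′*aQ′λ⟩ = Σ_{j=0}^{k} Σ_{y∈Λ_j} a_j(L^jη)^{d−2}|(Q′_jλ)(y)|². (2.14)»; p. 234: «**Proposition 2.2.** If we have
(2.1), (2.2) and M is sufficiently large, then the operator G′ = Δ′_a^{−1} (a = 1) satisfies the inequalities
|(G′λ)(x)|, …, |(Δ^ηG′λ)(x)| ≤ O(1)[(L^jη)², …, 1]·e^{−½δ₀d(y,y′)}|λ|, x ∈ B^j(y) …, y ∈ Λ_j, supp λ ⊂ B^{j′}(y′),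
y′ ∈ Λ_{j′}. (2.67)»

## WHAT THIS FILE CERTIFIES (kernel-checked; setting of files 1–5)

For the genuine `k`-level operator `Δ′_a = mlOp = −Δ^N + Q′*aQ′` (file 1; `Λ_j` = the ZONES (2.3), `lev = j`) of a
nested family `D : Domains d ℓ M_h k P R` on the box, `G′ = gml`, the blocks `𝔅`/`blkOf`/distance `d` of `geom D`
(file 4), in the majorant language of `B6RandomWalk`:
* §1 the averaging part `vOp = Δ′_a − (−Δ^N) = Q′*aQ′` (entries `vOp_apply`: `a_j(L^j)^{−2}L^{−j(d+1)}[x′ ∼_j x]` at a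
  site `x` of level `j`, from file 1's `mlOp_apply`), the identity `(−Δ^N)G′ = 1 − Q′*aQ′G′` (`lap_mul_gml`), the
  block count `#{x′ ∈ X : x′ ∼_j x} ≤ L^{j(d+1)}` (`card_blkClass_le`) and the row bound
  `|(Q′*aQ′g)(x)| ≤ a_j(L^j)^{−2}·sup_{B^j(y(x))}|g|` (`vOp_mulVec_abs_le`);
* §2 **PROPOSITION 2.2, SIXTH ENTRY, FOR THE GENUINE `k`-LEVEL OPERATOR** `prop22_sixth_multiLevelBox`: there are
  `δ₀, C, M₀ > 0` and `N₀` (those of file 5's first entry, `C` enlarged) such that under the same hypotheses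
  `|((−Δ^N)G′λ)(x)| ≤ C·e^{−½δ₀d(y,y′)}|λ|` for `x ∈ B^j(y)`, `supp λ ⊂ B^{j′}(y′)`
  (`HasMajorant (blkOf D) (toLin' (opBoxR 1 0 0 1 N * gml))`, print's factor «1») — `λ(x)` is supported in `y′`
  (`d(y′,y′) = 0`) and `Q′*aQ′G′λ` at a level-`j` site averages `G′λ` over the `j`-block of `x`, all of whose sites lie
  in the same block `y ∈ 𝔅`, so the first entry `C·L^{2j}e^{−½δ₀d}` times `a_j(L^j)^{−2}` gives `a₊C·e^{−½δ₀d}`.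

## HONEST SCOPE

As files 1–5: levels `1 … k` on a Neumann box (`−Δ^N` the Neumann Laplacian of the box), `m² = 0`, `M_h ≥ 3`; lattice
units (`G′` here is `η^{−2}G′` of print and `Δ^1 = η²Δ^η`, so `Δ^1G′ = Δ^ηG′_print` and the factor is «1»); constants
existential.  Nothing is inferred from the manuscript: every step is kernel-checked.
-/

namespace Literature.MathematicalPhysics.QuantumFieldTheory.Balaban1983to89.B6Prop22LapMultiLevelBoxL0

open Finset Matrix
open Literature.MathematicalPhysics.QuantumFieldTheory.Balaban1983to89.B4Reflection242 (boxDom mem_boxDom blk avgK diagK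
  neumannLapK)
open Literature.MathematicalPhysics.QuantumFieldTheory.Balaban1983to89.B4Green244 (finePt)
open Literature.MathematicalPhysics.QuantumFieldTheory.Balaban1983to89.B4BoxCov237 (opBoxR finePt_offset_of_blk)
open Literature.MathematicalPhysics.QuantumFieldTheory.Balaban1983to89.B6Ineq243TwoLevelBox (aNext)
open Literature.MathematicalPhysics.QuantumFieldTheory.Balaban1983to89.B6MultiLevelBoxOperator hiding Domains mlOp_apply
open Literature.MathematicalPhysics.QuantumFieldTheory.Balaban1983to89.B6MultiLevelBoxOperatorL0
open Literature.MathematicalPhysics.QuantumFieldTheory.Balaban1983to89.B6Geom246MultiLevelBox hiding Touch blkOf blkOf_corner blkOf_eq_iff_blk blkOf_eq_of_blk_i_eq blkOf_val bond bond_adj bset cen connected coord_bounds corner corner_mem csys dist_blkOf_le_box dist_blkOf_le_coord dist_blkOf_le_line dist_cen_le_of_adj dist_cen_le_of_touch dist_le_one_of_near dist_toR_cen_le exists_blkOf_eq geom lemma21_box lev_corner lev_eq_of_blkOf_eq levelGap pack reachable_blkOf reachable_of_near realizes scale_bounds touch_symm triangle_refl_nonneg walk_disp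
open Literature.MathematicalPhysics.QuantumFieldTheory.Balaban1983to89.B6Geom246MultiLevelBoxL0
open Literature.MathematicalPhysics.QuantumFieldTheory.Balaban1983to89.B6Prop22MultiLevelBox hiding Dd_le_supNorm aX_mulVec_apply bX_row_img bX_row_off dist_blkOf_le_in_cube fixedPoint_gml gX_row_img gX_row_off gZeroML_majorant lev_window_of_inCube mem_keySet_of_aX_ne_zero prop22_first_multiLevelBox rML_majorant
open Literature.MathematicalPhysics.QuantumFieldTheory.Balaban1983to89.B6Prop22MultiLevelBoxL0
open Literature.MathematicalPhysics.QuantumFieldTheory.Balaban1983to89.B6RandomWalk (HasMajorant BlockSupp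
  hasMajorant_mono)

open Literature.MathematicalPhysics.QuantumFieldTheory.Balaban1983to89.B6Prop22LapMultiLevelBox (vOp lap_eq_mlOp_sub)
noncomputable section

variable {d : ℕ}

/-! ## §1 The averaging part `Q′*aQ′` and the identity `(−Δ^N)G′ = 1 − Q′*aQ′G′` -/

section Averaging

variable {ℓ Mh k R : ℕ} {P : Fin (d + 1) → ℕ}

/-- entries of the pure Laplacian piece: `opBoxR 1 0 0 1 N = −Δ^N_X`. [folklore] -/
private theorem opBoxR_lap_apply (N : Fin (d + 1) → ℕ) (x y : ↥(boxDom N)) :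
    opBoxR 1 0 0 1 N x y = neumannLapK N x.1 y.1 := by
  simp [opBoxR, diagK, avgK]

/-- **ENTRIES OF `Q′*aQ′`**: `(Q′*aQ′)(x, x′) = a_j(L^j)^{−2}L^{−j(d+1)}·[x′ ∼_j x]`, `j` = the level of `x` (the sum
(2.14) over levels collapses to the zone of `x`, file 1's `mlOp_apply`). [cite: Balaban1984PropagatorsII, (2.14) p.225] -/
theorem vOp_apply (D : Domains d ℓ Mh k P R) (a : ℕ → ℝ) (x y : ↥(boxDom (N0 ℓ Mh k P))) :
    vOp (N0 ℓ Mh k P) ℓ k (Domains.lev D) a x y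
      = avgK (levC d ℓ a (Domains.lev D x.1)) ((ℓ + 1) ^ Domains.lev D x.1) x.1 y.1 := by
  unfold vOp
  rw [Matrix.sub_apply, mlOp_apply D rfl a x y, opBoxR_lap_apply]
  ring

/-- **`(−Δ^N)G′ = 1 − Q′*aQ′G′`** for the genuine operator (`Δ′_aG′ = 1`). [cite: Balaban1984PropagatorsII, (2.13)–(2.14) p.225, (2.67) p.234 (sixth entry)] -/
theorem lap_mul_gml (D : Domains d ℓ Mh k P R) {a : ℕ → ℝ} (hP : ∀ μ, 1 ≤ P μ) (hMh : 1 ≤ Mh)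
    (ha : ∀ j, 0 < a j) :
    opBoxR 1 0 0 1 (N0 ℓ Mh k P) * gml (N0 ℓ Mh k P) ℓ k D.lev a
      = 1 - vOp (N0 ℓ Mh k P) ℓ k D.lev a * gml (N0 ℓ Mh k P) ℓ k D.lev a := by
  have hGE : gml (N0 ℓ Mh k P) ℓ k D.lev a * mlOp (N0 ℓ Mh k P) ℓ k D.lev a = 1 :=
    gml_mul_mlOp (fun μ => Nat.one_le_iff_ne_zero.2 (by have := hP μ; have := hMh; positivity)) D.lev_le ha
  have hEG : mlOp (N0 ℓ Mh k P) ℓ k D.lev a * gml (N0 ℓ Mh k P) ℓ k D.lev a = 1 := mul_eq_one_comm.1 hGE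
  rw [lap_eq_mlOp_sub (N0 ℓ Mh k P) ℓ k D.lev a, Matrix.sub_mul, hEG]

/-- a block class of the box has at most `n^{d+1}` sites. [folklore] -/
private theorem card_blkClass_le {n : ℕ} (hn : 1 ≤ n) (N : Fin (d + 1) → ℕ) (x : ↥(boxDom N)) :
    (Finset.univ.filter fun z : ↥(boxDom N) => blk n z.1 = blk n x.1).card ≤ n ^ (d + 1) := by
  have hsub : (Finset.univ.filter fun z : ↥(boxDom N) => blk n z.1 = blk n x.1).image (fun z => z.1)
      ⊆ (Finset.univ : Finset (Fin (d + 1) → Fin n)).image (finePt n (blk n x.1)) := by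
    intro w hw
    rw [Finset.mem_image] at hw ⊢
    obtain ⟨z, hz, rfl⟩ := hw
    rw [Finset.mem_filter] at hz
    obtain ⟨j, hj⟩ := finePt_offset_of_blk hn hz.2
    exact ⟨j, Finset.mem_univ _, hj⟩
  calc (Finset.univ.filter fun z : ↥(boxDom N) => blk n z.1 = blk n x.1).card
      = ((Finset.univ.filter fun z : ↥(boxDom N) => blk n z.1 = blk n x.1).image (fun z => z.1)).card :=
        (Finset.card_image_of_injective _ Subtype.val_injective).symm
    _ ≤ ((Finset.univ : Finset (Fin (d + 1) → Fin n)).image (finePt n (blk n x.1))).card := Finset.card_le_card hsub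
    _ ≤ (Finset.univ : Finset (Fin (d + 1) → Fin n)).card := Finset.card_image_le
    _ = n ^ (d + 1) := by rw [Finset.card_univ, Fintype.card_fun, Fintype.card_fin, Fintype.card_fin]

/-- **THE ROW BOUND OF `Q′*aQ′`**: if `|g| ≤ G` on the block `y(x) ∈ 𝔅` of `x` (level `j`), then
`|(Q′*aQ′g)(x)| ≤ a_j(L^j)^{−2}·G` — the `j`-block of `x` lies in `y(x)` and has at most `L^{j(d+1)}` sites.
[cite: Balaban1984PropagatorsII, (2.14) p.225, (2.1) p.224 (territories are unions of blocks), dictionary] -/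
theorem vOp_mulVec_abs_le (D : Domains d ℓ Mh k P R) {a : ℕ → ℝ} (ha0 : ∀ j, 0 ≤ a j)
    (g : ↥(boxDom (N0 ℓ Mh k P)) → ℝ) (x : ↥(boxDom (N0 ℓ Mh k P))) {G : ℝ}
    (hg : ∀ z, blkOf D z = blkOf D x → |g z| ≤ G) :
    |(vOp (N0 ℓ Mh k P) ℓ k D.lev a *ᵥ g) x| ≤ a (D.lev x.1) * ((((ℓ : ℝ) + 1) ^ D.lev x.1) ^ 2)⁻¹ * G := by
  have hG0 : 0 ≤ G := (abs_nonneg _).trans (hg x rfl)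
  have hc0 : 0 ≤ levC d ℓ a (D.lev x.1) := by
    unfold levC; have := ha0 (D.lev x.1); positivity
  have hb1 : 1 ≤ (ℓ + 1) ^ D.lev x.1 := Nat.one_le_pow _ _ (by omega)
  simp only [Matrix.mulVec, dotProduct]
  -- each term: `avgK·g`, non-zero only on the block class of `x`
  have hterm : ∀ z : ↥(boxDom (N0 ℓ Mh k P)), |vOp (N0 ℓ Mh k P) ℓ k D.lev a x z * g z|
      ≤ if blk ((ℓ + 1) ^ D.lev x.1) z.1 = blk ((ℓ + 1) ^ D.lev x.1) x.1 then levC d ℓ a (D.lev x.1) * G else 0 := by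
    intro z
    rw [vOp_apply D a x z]
    unfold avgK
    by_cases hz : blk ((ℓ + 1) ^ D.lev x.1) z.1 = blk ((ℓ + 1) ^ D.lev x.1) x.1
    · rw [if_pos hz, if_pos hz, abs_mul, abs_of_nonneg hc0]
      exact mul_le_mul_of_nonneg_left (hg z (blkOf_eq_of_blk_i_eq (D := D) le_rfl hz)) hc0
    · rw [if_neg hz, if_neg hz, zero_mul, abs_zero]
  calc |∑ z, vOp (N0 ℓ Mh k P) ℓ k D.lev a x z * g z|
      ≤ ∑ z, |vOp (N0 ℓ Mh k P) ℓ k D.lev a x z * g z| := Finset.abs_sum_le_sum_abs _ _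
    _ ≤ ∑ z, (if blk ((ℓ + 1) ^ D.lev x.1) z.1 = blk ((ℓ + 1) ^ D.lev x.1) x.1 then levC d ℓ a (D.lev x.1) * G
          else 0) := Finset.sum_le_sum fun z _ => hterm z
    _ = ((Finset.univ.filter fun z : ↥(boxDom (N0 ℓ Mh k P)) =>
          blk ((ℓ + 1) ^ D.lev x.1) z.1 = blk ((ℓ + 1) ^ D.lev x.1) x.1).card : ℝ) * (levC d ℓ a (D.lev x.1) * G) := by
        rw [← Finset.sum_filter, Finset.sum_const, nsmul_eq_mul]
    _ ≤ ((((ℓ + 1) ^ D.lev x.1) ^ (d + 1) : ℕ) : ℝ) * (levC d ℓ a (D.lev x.1) * G) := by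
        refine mul_le_mul_of_nonneg_right ?_ (mul_nonneg hc0 hG0)
        exact_mod_cast card_blkClass_le hb1 _ x
    _ = a (D.lev x.1) * ((((ℓ : ℝ) + 1) ^ D.lev x.1) ^ 2)⁻¹ * G := by
        unfold levC
        have hL : (((ℓ : ℝ) + 1) ^ D.lev x.1) ^ (d + 1) ≠ 0 := by positivity
        push_cast
        field_simp

end Averaging

/-! ## §2 Proposition 2.2, sixth entry, for the genuine `k`-level operator -/

section Prop22

variable {ℓ Mh k R : ℕ} {P : Fin (d + 1) → ℕ}

/-- **[B6] PROPOSITION 2.2, SIXTH ENTRY OF (2.67) (`Δ^ηG′λ`), FOR THE GENUINE `k`-LEVEL OPERATOR `G′ = Δ′_a^{−1}` ON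
A BOX**: there are `δ₀, C, M₀ > 0` and `N₀ ≥ 1` (functions of `d`, `ℓ` and the windows) such that for EVERY number of
levels `k`, `M_h ≥ 3` with `L·M_h ≥ M₀`, `R ≥ 2L` with `RM ≥ N₀ + 1`, volume `P`, nested family `D` of domains
(2.1)–(2.2), weights `a_i ∈ [a₋, a₊]`, `c_i ∈ [c₋, c₊]` with `a_{i+1} = aNext ℓ a_i c_i`:
`|((−Δ^N)G′λ)(x)| ≤ C·e^{−½δ₀d(y,y′)}·|λ|` for `x ∈ B^j(y)`, `y ∈ Λ_j`, `supp λ ⊂ B^{j′}(y′)`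
(`HasMajorant` of `(−Δ^N)G′`, print's factor «1») — from the first entry (file 5 `prop22_first_multiLevelBox`) and
`(−Δ^N)G′ = 1 − Q′*aQ′G′` with the row bound of `Q′*aQ′`. [cite: Balaban1984PropagatorsII, Proposition 2.2 (2.67) p.234 (sixth entry), (2.13)–(2.14) p.225] -/
theorem prop22_sixth_multiLevelBox (d ℓ : ℕ) (hℓ : 1 ≤ ℓ) (aminus aplus a2minus a2plus : ℝ) (ha : 0 < aminus)
    (ha2 : 0 < a2minus) :
    ∃ δ₀ C M₀ : ℝ, ∃ N₀ : ℕ, 0 < δ₀ ∧ 0 < C ∧ 0 < M₀ ∧ 0 < N₀ ∧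
      ∀ (k Mh R : ℕ), 3 ≤ Mh → M₀ ≤ ((ℓ : ℝ) + 1) * Mh → 2 * (ℓ + 1) ≤ R → N₀ + 1 ≤ R * ((ℓ + 1) * Mh) →
      ∀ (P : Fin (d + 1) → ℕ) (hP : ∀ μ, 1 ≤ P μ) (D : Domains d ℓ Mh k P R) (a c : ℕ → ℝ),
        (∀ i, aminus ≤ a i ∧ a i ≤ aplus) → (∀ i, a2minus ≤ c i ∧ c i ≤ a2plus) →
        (∀ i, a (i + 1) = aNext ℓ (a i) (c i)) →
        HasMajorant (g := geom D) (blkOf D)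
          (Matrix.toLin' (opBoxR 1 0 0 1 (N0 ℓ Mh k P) * gml (N0 ℓ Mh k P) ℓ k D.lev a))
          (fun y y' => C * Real.exp (-(δ₀ / 2 * (geom D).dist y y'))) := by
  obtain ⟨δ₀, C, M₀, N₀, hδ₀, hC, hM₀, hN₀, hfirst⟩ :=
    prop22_first_multiLevelBox d ℓ hℓ aminus aplus a2minus a2plus ha ha2
  refine ⟨δ₀, |aplus| * C + 1, M₀, N₀, hδ₀, by positivity, hM₀, hN₀, ?_⟩
  intro k Mh R hMh hM hR hRM P hP D a c haw hcw hac y' lam B hlam x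
  have hMh1 : 1 ≤ Mh := le_trans (by norm_num) hMh
  have hMh2 : 2 ≤ Mh := le_trans (by norm_num) hMh
  have hG := hfirst k Mh R hMh hM hR hRM P hP D a c haw hcw hac
  have hapos : ∀ j, 0 < a j := fun j => lt_of_lt_of_le ha (haw j).1
  obtain ⟨-, hrefl, hdnn⟩ := triangle_refl_nonneg D hMh1 hP
  have hB0 : 0 ≤ B := hlam.nonneg
  rw [Matrix.toLin'_apply, lap_mul_gml D hP hMh1 hapos, Matrix.sub_mulVec, Matrix.one_mulVec, Pi.sub_apply,
    ← Matrix.mulVec_mulVec]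
  set e0 : ℝ := Real.exp (-(δ₀ / 2 * (geom D).dist (blkOf D x) y')) with he0
  have he0pos : 0 < e0 := Real.exp_pos _
  -- the source term `λ(x)`: supported in the block `y′`, where `d(y′,y′) = 0`
  have hlamx : |lam x| ≤ e0 * B := by
    by_cases hx : blkOf D x = y'
    · have : e0 = 1 := by rw [he0, hx, hrefl, mul_zero, neg_zero, Real.exp_zero]
      rw [this, one_mul]; exact hlam.bound x hx
    · rw [hlam.off x hx, abs_zero]; positivity
  -- the averaging term: the first entry on the block of `x`, times `a_j(L^j)^{−2}`
  have hgz : ∀ z, blkOf D z = blkOf D x →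
      |(gml (N0 ℓ Mh k P) ℓ k D.lev a *ᵥ lam) z| ≤ C * ((ℓ : ℝ) + 1) ^ (2 * D.lev x.1) * e0 * B := by
    intro z hz
    have h := hG y' lam B hlam z
    rw [Matrix.toLin'_apply, hz] at h
    exact h
  have hV := vOp_mulVec_abs_le D (fun j => (hapos j).le) _ x hgz
  have hax : a (D.lev x.1) ≤ |aplus| := (haw _).2.trans (le_abs_self _)
  have hLpow : (0 : ℝ) < (((ℓ : ℝ) + 1) ^ D.lev x.1) ^ 2 := by positivity
  have hV' : |(vOp (N0 ℓ Mh k P) ℓ k D.lev a *ᵥ (gml (N0 ℓ Mh k P) ℓ k D.lev a *ᵥ lam)) x| ≤ |aplus| * C * e0 * B := by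
    refine hV.trans ?_
    have hsimp : a (D.lev x.1) * ((((ℓ : ℝ) + 1) ^ D.lev x.1) ^ 2)⁻¹ * (C * ((ℓ : ℝ) + 1) ^ (2 * D.lev x.1) * e0 * B)
        = a (D.lev x.1) * (C * e0 * B) := by
      rw [pow_mul']
      field_simp
    rw [hsimp]
    calc a (D.lev x.1) * (C * e0 * B) ≤ |aplus| * (C * e0 * B) :=
          mul_le_mul_of_nonneg_right hax (by positivity)
      _ = |aplus| * C * e0 * B := by ring
  calc |lam x - (vOp (N0 ℓ Mh k P) ℓ k D.lev a *ᵥ (gml (N0 ℓ Mh k P) ℓ k D.lev a *ᵥ lam)) x|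
      ≤ |lam x| + |(vOp (N0 ℓ Mh k P) ℓ k D.lev a *ᵥ (gml (N0 ℓ Mh k P) ℓ k D.lev a *ᵥ lam)) x| := abs_sub _ _
    _ ≤ e0 * B + |aplus| * C * e0 * B := add_le_add hlamx hV'
    _ = (|aplus| * C + 1) * e0 * B := by ring

end Prop22

end

end Literature.MathematicalPhysics.QuantumFieldTheory.Balaban1983to89.B6Prop22LapMultiLevelBoxL0
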